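import Summits.Ventures.YMGap.RobustBall.SummableDoor
import HarnessLib

/-!
# Venture YMGap, track ROBUST-BALL (tier 2) — zero-diagonal Dobrushin rows and DLR UNIQUENESS for SUMMABLE
# (infinite-range) perturbations of strong-coupling `SU(N)` lattice Yang–Mills on `ℤ^d`

HONEST FRAMING. WHAT THIS IS: a venture file (cell `pub-ymgap`, track Y2 ROBUST-BALL, seat rb-p1), first half
of the TIER-2 MASS-GAP THEOREM of the robust ball (second half: `SummableMassGap.lean`). A member is
`N β S_W + W` with `W` ANY link potential on `ℤ^d` with continuous terms depending on their own links and a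
summable majorant (`IsLinkSummable W B`) — no range cut-off, no list of supports. Its loads are NUMBERS: the
oscillation load `a ≥ ∑'_{X ∋ e} osc X e` and the `e^{t ‖·‖_∞}`-WEIGHTED, DIAGONAL-FREE cross-Lipschitz load
`Λ_t ≥ ∑'_{y ≠ e} ℓ(e, y) e^{t ‖e - y‖_∞}`, `ℓ(e, y) ≥ ∑'_{X ∋ e, y} lip X y` (`y ≠ e`; Dobrushin's matrix
has zero diagonal — the one-link law at `e` does not read the link `e` — so the Lipschitz moduli of the
terms in the updated link never enter). This file: the rows of the zero-diagonal coefficients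
`C⁰(e, y) = 𝟙[y ≠ e](e^{a} √(c v) |β| n(e, y) + e^{a/2} √c ℓ(e, y))` (`summable_coeffS_row₀`), the GLOBAL
summable Vasserstein bound with `C⁰` (`abs_integral_siteLaw_perturbedYMS_sub_le_tsum₀`, from the sitewise
bound and quasilocality of `SummableDoor.lean` through lit-1's `global_of_sitewise_of_quasilocal`), and
(i) DLR UNIQUENESS under the weighted row condition `6(d-1)|β| e^{a} e^{t} √(c v) + e^{a/2} √c Λ_t < 1`
(`subsingleton_perturbedGibbsMeasuresS_SU`; lit-1's `subsingleton_gibbsMeasures_of_summable`, Föllmer's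
uniqueness theorem (2.9) with summable rows). The one-link Poincaré/variance pair `(c, v)` on the ball
`‖B‖_op ≤ 2(d-1)|β|` enters as the hypotheses `hP`, `hVB` of tier 1. WHAT IT IS NOT: a lattice
strong-coupling theorem; no claim about the continuum limit or the Clay Millennium problem.

## References

* H. Föllmer, LNM 1362 (1988), Ch. I, (2.7), (2.9), (2.20).
* H.-O. Georgii, *Gibbs Measures and Phase Transitions* (2011), Thm. 8.7.
-/

noncomputable section

open MeasureTheory Filter Function ProbabilityTheory Real Topology
open scoped NNReal
open Literature.Probability.LatticeModels
open Literature.Probability.LatticeModels.DobrushinMetric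
open Literature.MathematicalPhysics.QuantumLattice
open Literature.MathematicalPhysics.QuantumFieldTheory hiding ZdEdge

namespace Summit.Ventures.YMGap.RobustBall

variable {d N : ℕ}

/-! ### The diagonal-free coefficients `C⁰(e, y) = 𝟙[y ≠ e] (e^{a} √(c v) |β| n(e, y) + e^{a/2} √c ℓ(e, y))` -/

/-- **Rows of the diagonal-free tier-2 coefficients, weighted and unweighted**: with the diagonal-free
weighted cross load `∑'_y 𝟙[y ≠ e] ℓ(e, y) e^{t‖e - y‖_∞} ≤ Λ_t` (`t ≥ 0`) both the plain and the
`e^{t‖·‖_∞}`-weighted rows of `C⁰(e, ·)` are summable with sums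
`≤ 6(d-1)|β| e^{a} e^{t} √(c v) + e^{a/2} √c Λ_t` (`summable_coeffS_row`). -/
theorem summable_coeffS_row₀ (hd : 1 ≤ d) {β c v a Λt t : ℝ} {ℓ : ZdEdge d → ZdEdge d → ℝ}
    (hℓ0 : ∀ e y, y ≠ e → 0 ≤ ℓ e y) (ht : 0 ≤ t)
    (hℓs : ∀ e, Summable fun y => (if y = e then 0 else ℓ e y) * exp (t * ‖e.1 - y.1‖))
    (hℓt : ∀ e, ∑' y, (if y = e then 0 else ℓ e y) * exp (t * ‖e.1 - y.1‖) ≤ Λt) (e : ZdEdge d) :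
    (Summable fun y => (if y = e then 0 else
        (exp a * Real.sqrt (c * v) * |β| * linkInfluence e y + exp (a / 2) * Real.sqrt c * ℓ e y))) ∧
    (Summable fun y => (if y = e then 0 else
        (exp a * Real.sqrt (c * v) * |β| * linkInfluence e y + exp (a / 2) * Real.sqrt c * ℓ e y)) * exp (t * ‖e.1 - y.1‖)) ∧
    (∑' y, (if y = e then 0 else
        (exp a * Real.sqrt (c * v) * |β| * linkInfluence e y + exp (a / 2) * Real.sqrt c * ℓ e y)) ≤
      6 * ((d : ℝ) - 1) * |β| * (exp a * exp t * Real.sqrt (c * v)) + exp (a / 2) * Real.sqrt c * Λt) ∧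
    (∑' y, (if y = e then 0 else
        (exp a * Real.sqrt (c * v) * |β| * linkInfluence e y + exp (a / 2) * Real.sqrt c * ℓ e y)) * exp (t * ‖e.1 - y.1‖) ≤
      6 * ((d : ℝ) - 1) * |β| * (exp a * exp t * Real.sqrt (c * v)) + exp (a / 2) * Real.sqrt c * Λt) := by
  obtain ⟨hs, hle⟩ := summable_coeffS_row (β := β) (c := c) (v := v) (a := a)
    (ℓ := fun e y => if y = e then 0 else ℓ e y) hd ht hℓs hℓt e
  have hC0 : ∀ y, 0 ≤ (if y = e then 0 else
        (exp a * Real.sqrt (c * v) * |β| * linkInfluence e y + exp (a / 2) * Real.sqrt c * ℓ e y)) := fun y => by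
    split_ifs with hye
    · exact le_rfl
    · exact add_nonneg (by positivity) (mul_nonneg (by positivity) (hℓ0 e y hye))
  have hle1 : ∀ y, (if y = e then 0 else
        (exp a * Real.sqrt (c * v) * |β| * linkInfluence e y + exp (a / 2) * Real.sqrt c * ℓ e y)) ≤
      exp a * Real.sqrt (c * v) * |β| * linkInfluence e y + exp (a / 2) * Real.sqrt c * (if y = e then 0 else ℓ e y) :=
    fun y => by
      split_ifs with hye
      · simp only [mul_zero, add_zero]; positivity
      · exact le_rfl
  have hw1 : ∀ y : ZdEdge d, 1 ≤ exp (t * ‖e.1 - y.1‖) := fun y => one_le_exp (by positivity)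
  have hsw : Summable fun y => (if y = e then 0 else
        (exp a * Real.sqrt (c * v) * |β| * linkInfluence e y + exp (a / 2) * Real.sqrt c * ℓ e y)) * exp (t * ‖e.1 - y.1‖) :=
    Summable.of_nonneg_of_le (fun y => mul_nonneg (hC0 y) (exp_pos _).le)
      (fun y => mul_le_mul_of_nonneg_right (hle1 y) (exp_pos _).le) hs
  have hs0 : Summable fun y => (if y = e then 0 else
        (exp a * Real.sqrt (c * v) * |β| * linkInfluence e y + exp (a / 2) * Real.sqrt c * ℓ e y)) :=
    Summable.of_nonneg_of_le hC0 (fun y => le_mul_of_one_le_right (hC0 y) (hw1 y)) hsw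
  have hsum : ∑' y, (if y = e then 0 else
        (exp a * Real.sqrt (c * v) * |β| * linkInfluence e y + exp (a / 2) * Real.sqrt c * ℓ e y)) * exp (t * ‖e.1 - y.1‖) ≤
      6 * ((d : ℝ) - 1) * |β| * (exp a * exp t * Real.sqrt (c * v)) + exp (a / 2) * Real.sqrt c * Λt :=
    (hsw.tsum_le_tsum (fun y => mul_le_mul_of_nonneg_right (hle1 y) (exp_pos _).le) hs).trans hle
  exact ⟨hs0, hsw, (hs0.tsum_le_tsum (fun y => le_mul_of_one_le_right (hC0 y) (hw1 y)) hsw).trans hsum, hsum⟩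

section SUN

variable {W : Potential (ZdEdge d) (Matrix.specialUnitaryGroup (Fin N) ℂ)} {B : Finset (ZdEdge d) → ℝ}

/-- **The global summable Vasserstein bound with ZERO DIAGONAL** (Föllmer 1988, Ch. I, (2.20): Dobrushin's
matrix `C_{ik}`, `i ≠ k`; lit-1's `global_of_sitewise_of_quasilocal`): for ALL boundary conditions,
`|∫ φ dγ^W_e(·|ω) - ∫ φ dγ^W_e(·|η)| ≤ L ∑'_y C⁰(e, y) ‖ω_y - η_y‖_F` with
`C⁰(e, y) = 𝟙[y ≠ e](e^{a} √(c v) |β| n(e, y) + e^{a/2} √c ℓ(e, y))` — the law at `e` does not read the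
link `e` (`siteLaw_congr_of_eq_off'`), so the Lipschitz moduli of the terms in `e` itself never enter;
`ℓ(e, y) ≥ ∑'_{X ∋ e, y} lip X y` is required for `y ≠ e` only, with `∑'_{y ≠ e} ℓ(e, y) < ∞`. -/
theorem abs_integral_siteLaw_perturbedYMS_sub_le_tsum₀ (hd : 1 ≤ d) (hN : 1 ≤ N) {β b c v a : ℝ}
    (hc : 0 ≤ c) (hv : 0 ≤ v) (hb : |β| * (2 * ((d : ℝ) - 1)) ≤ b)
    (hP : ∀ B : Matrix (Fin N) (Fin N) ℂ, matrixOpNorm B ≤ b →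
      ∀ (ψ : Matrix.specialUnitaryGroup (Fin N) ℂ → ℝ) (M : ℝ), 0 ≤ M →
        (∀ x y, |ψ x - ψ y| ≤ M * suFrobDist x y) →
        Var[ψ; (haarProbability (Matrix.specialUnitaryGroup (Fin N) ℂ)).tilted
          fun g => (N : ℝ) * ((g : Matrix (Fin N) (Fin N) ℂ) * B).trace.re] ≤ c * M ^ 2)
    (hVB : ∀ B : Matrix (Fin N) (Fin N) ℂ, matrixOpNorm B ≤ b → ∀ Δ : Matrix (Fin N) (Fin N) ℂ,
      Var[fun g : Matrix.specialUnitaryGroup (Fin N) ℂ =>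
          (N : ℝ) * ((g : Matrix (Fin N) (Fin N) ℂ) * Δ).trace.re;
        (haarProbability (Matrix.specialUnitaryGroup (Fin N) ℂ)).tilted
          fun g => (N : ℝ) * ((g : Matrix (Fin N) (Fin N) ℂ) * B).trace.re] ≤ v * frobNorm Δ ^ 2)
    (h : IsLinkSummable W B) (hWc : ∀ X, Continuous (W X))
    (hWdep : ∀ X, DependsOn (W X) (↑X : Set (ZdEdge d)))
    {osc : Finset (ZdEdge d) → ZdEdge d → ℝ} (hosc : ∀ X, Dobrushin.IsOscBound (W X) (osc X))
    (hoscs : ∀ e, Summable fun X : Finset (ZdEdge d) => (if e ∈ X then osc X e else 0))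
    (hosca : ∀ e, ∑' X : Finset (ZdEdge d), (if e ∈ X then osc X e else 0) ≤ a)
    {lip : Finset (ZdEdge d) → ZdEdge d → ℝ} (hlip : ∀ X, IsLipBound suFrobDist (W X) (lip X))
    {ℓ : ZdEdge d → ZdEdge d → ℝ}
    (hlips : ∀ e y, Summable fun X : Finset (ZdEdge d) => (if e ∈ X ∧ y ∈ X then lip X y else 0))
    (hℓ : ∀ e y, y ≠ e → ∑' X : Finset (ZdEdge d), (if e ∈ X ∧ y ∈ X then lip X y else 0) ≤ ℓ e y)
    (hℓs : ∀ e, Summable fun y => (if y = e then 0 else ℓ e y))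
    (e : ZdEdge d) (ω η : LGConfig d (Matrix.specialUnitaryGroup (Fin N) ℂ))
    (φ : Matrix.specialUnitaryGroup (Fin N) ℂ → ℝ) (L : ℝ)
    (hφm : Measurable φ) (hφb : ∃ M, ∀ s, |φ s| ≤ M) (hL : 0 ≤ L)
    (hφL : ∀ x y, |φ x - φ y| ≤ L * suFrobDist x y) :
    |∫ s, φ s ∂(siteLaw (perturbedYMS (fundamentalRep (Fin N)) (N * β) W) e ω) -
        ∫ s, φ s ∂(siteLaw (perturbedYMS (fundamentalRep (Fin N)) (N * β) W) e η)| ≤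
      L * ∑' y, (if y = e then 0 else
        (exp a * Real.sqrt (c * v) * |β| * linkInfluence e y + exp (a / 2) * Real.sqrt c * ℓ e y)) * suFrobDist (ω y) (η y) := by
  classical
  haveI : SecondCountableTopology (Matrix (Fin N) (Fin N) ℂ) :=
    inferInstanceAs (SecondCountableTopology (Fin N → Fin N → ℂ))
  haveI : SecondCountableTopology (Matrix.specialUnitaryGroup (Fin N) ℂ) :=
    Topology.IsEmbedding.subtypeVal.secondCountableTopology
  have hγ : IsSpecification (perturbedYMS (d := d) (fundamentalRep (Fin N)) (N * β) W) :=
    isSpecification_perturbedYMS _ (continuous_fundamentalRep (Fin N)) _ h hWc hWdep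
  have hℓ0 : ∀ x y, y ≠ x → 0 ≤ ℓ x y := fun x y hyx => by
    refine le_trans (tsum_nonneg fun X => ?_) (hℓ x y hyx)
    split_ifs
    · exact (hlip X).nonneg y
    · exact le_rfl
  have hC0 : ∀ x y : ZdEdge d, 0 ≤ (if y = x then 0 else
      (exp a * Real.sqrt (c * v) * |β| * linkInfluence x y + exp (a / 2) * Real.sqrt c * ℓ x y)) :=
    fun x y => by
      split_ifs with hyx
      · exact le_rfl
      · exact add_nonneg (by positivity) (mul_nonneg (by positivity) (hℓ0 x y hyx))
  have hCs : ∀ x : ZdEdge d, Summable fun y => (if y = x then 0 else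
      (exp a * Real.sqrt (c * v) * |β| * linkInfluence x y + exp (a / 2) * Real.sqrt c * ℓ x y)) := by
    intro x
    obtain ⟨hn, -⟩ := summable_linkInfluence_mul hd x (w := fun _ => (1 : ℝ)) (M := 1)
      (fun _ => zero_le_one) (fun _ _ => le_rfl)
    simp only [mul_one] at hn
    have hs : Summable fun y => exp a * Real.sqrt (c * v) * |β| * linkInfluence x y +
        exp (a / 2) * Real.sqrt c * (if y = x then 0 else ℓ x y) := (hn.mul_left _).add ((hℓs x).mul_left _)
    refine Summable.of_nonneg_of_le (hC0 x) (fun y => ?_) hs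
    split_ifs with hyx
    · simp only [mul_zero, add_zero]; positivity
    · exact le_rfl
  refine global_of_sitewise_of_quasilocal (γ := perturbedYMS (fundamentalRep (Fin N)) (N * β) W)
    (fun _ _ => suFrobDist_nonneg _ _) suFrobDist_le hC0 hCs e ?_
    (fun M L ε hε => siteLaw_perturbedYMS_quasilocal hd hN hc hv hb hP hVB h hWc hWdep hosc hoscs hosca
      e M L ε hε) ω η φ L hφm hφb hL hφL
  intro y ω η hωη φ L hφm hφb hL hφL
  by_cases hye : y = e
  · subst hye
    rw [siteLaw_congr_of_eq_off' hγ y hωη, sub_self, abs_zero, if_pos rfl, zero_mul, zero_mul]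
  · rw [if_neg hye]
    have key := abs_integral_siteLaw_perturbedYMS_sub_le hd hN hc hv hb hP hVB h hWc hWdep hosc hoscs hosca
      hlip (ℓ := fun e y => if y = e then
        ∑' X : Finset (ZdEdge d), (if e ∈ X ∧ y ∈ X then lip X y else 0) else ℓ e y)
      hlips (fun e' y' => ?_) e y ω η hωη φ L hφm hφb hL hφL
    · simpa only [if_neg hye] using key
    · by_cases hye' : y' = e'
      · subst hye'
        simp
      · simp only [if_neg hye']
        exact hℓ e' y' hye'

/-- **(i) DLR uniqueness for the tier-2 member** (Föllmer 1988, Ch. I, Uniqueness theorem (2.9) with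
summable rows; lit-1's `subsingleton_gibbsMeasures_of_summable`): under the weighted row condition
`6(d-1)|β| e^{a} e^{t} √(c v) + e^{a/2} √c Λ_t < 1` (any `t ≥ 0`; `t = 0` is the unweighted condition)
the summable member `N β S_W + W` has at most one DLR state on `ℤ^d`. -/
theorem subsingleton_perturbedGibbsMeasuresS_SU (hd : 1 ≤ d) (hN : 1 ≤ N) {β b c v a Λt t : ℝ}
    (hc : 0 ≤ c) (hv : 0 ≤ v) (hb : |β| * (2 * ((d : ℝ) - 1)) ≤ b)
    (hP : ∀ B : Matrix (Fin N) (Fin N) ℂ, matrixOpNorm B ≤ b →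
      ∀ (ψ : Matrix.specialUnitaryGroup (Fin N) ℂ → ℝ) (M : ℝ), 0 ≤ M →
        (∀ x y, |ψ x - ψ y| ≤ M * suFrobDist x y) →
        Var[ψ; (haarProbability (Matrix.specialUnitaryGroup (Fin N) ℂ)).tilted
          fun g => (N : ℝ) * ((g : Matrix (Fin N) (Fin N) ℂ) * B).trace.re] ≤ c * M ^ 2)
    (hVB : ∀ B : Matrix (Fin N) (Fin N) ℂ, matrixOpNorm B ≤ b → ∀ Δ : Matrix (Fin N) (Fin N) ℂ,
      Var[fun g : Matrix.specialUnitaryGroup (Fin N) ℂ =>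
          (N : ℝ) * ((g : Matrix (Fin N) (Fin N) ℂ) * Δ).trace.re;
        (haarProbability (Matrix.specialUnitaryGroup (Fin N) ℂ)).tilted
          fun g => (N : ℝ) * ((g : Matrix (Fin N) (Fin N) ℂ) * B).trace.re] ≤ v * frobNorm Δ ^ 2)
    (h : IsLinkSummable W B) (hWc : ∀ X, Continuous (W X))
    (hWdep : ∀ X, DependsOn (W X) (↑X : Set (ZdEdge d)))
    {osc : Finset (ZdEdge d) → ZdEdge d → ℝ} (hosc : ∀ X, Dobrushin.IsOscBound (W X) (osc X))
    (hoscs : ∀ e, Summable fun X : Finset (ZdEdge d) => (if e ∈ X then osc X e else 0))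
    (hosca : ∀ e, ∑' X : Finset (ZdEdge d), (if e ∈ X then osc X e else 0) ≤ a)
    {lip : Finset (ZdEdge d) → ZdEdge d → ℝ} (hlip : ∀ X, IsLipBound suFrobDist (W X) (lip X))
    {ℓ : ZdEdge d → ZdEdge d → ℝ}
    (hlips : ∀ e y, Summable fun X : Finset (ZdEdge d) => (if e ∈ X ∧ y ∈ X then lip X y else 0))
    (hℓ : ∀ e y, y ≠ e → ∑' X : Finset (ZdEdge d), (if e ∈ X ∧ y ∈ X then lip X y else 0) ≤ ℓ e y)
    (ht : 0 ≤ t) (hℓs : ∀ e, Summable fun y => (if y = e then 0 else ℓ e y) * exp (t * ‖e.1 - y.1‖))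
    (hℓt : ∀ e, ∑' y, (if y = e then 0 else ℓ e y) * exp (t * ‖e.1 - y.1‖) ≤ Λt)
    (hρ : 6 * ((d : ℝ) - 1) * |β| * (exp a * exp t * Real.sqrt (c * v)) + exp (a / 2) * Real.sqrt c * Λt < 1)
    :
    (perturbedGibbsMeasuresS (d := d) (fundamentalRep (Fin N)) (N * β) W).Subsingleton := by
  classical
  haveI : SecondCountableTopology (Matrix (Fin N) (Fin N) ℂ) :=
    inferInstanceAs (SecondCountableTopology (Fin N → Fin N → ℂ))
  haveI : SecondCountableTopology (Matrix.specialUnitaryGroup (Fin N) ℂ) :=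
    Topology.IsEmbedding.subtypeVal.secondCountableTopology
  have hγ : IsSpecification (perturbedYMS (d := d) (fundamentalRep (Fin N)) (N * β) W) :=
    isSpecification_perturbedYMS _ (continuous_fundamentalRep (Fin N)) _ h hWc hWdep
  have hℓ0 : ∀ x y, y ≠ x → 0 ≤ ℓ x y := fun x y hyx => by
    refine le_trans (tsum_nonneg fun X => ?_) (hℓ x y hyx)
    split_ifs
    · exact (hlip X).nonneg y
    · exact le_rfl
  have hrow := fun x => summable_coeffS_row₀ (β := β) (c := c) (v := v) (a := a) hd hℓ0 ht hℓs hℓt x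
  have hℓs' : ∀ e, Summable fun y => (if y = e then 0 else ℓ e y) := fun e =>
    Summable.of_nonneg_of_le (fun y => by split_ifs with hye; exacts [le_rfl, hℓ0 e y hye])
      (fun y => le_mul_of_one_le_right (by split_ifs with hye; exacts [le_rfl, hℓ0 e y hye])
        (one_le_exp (by positivity))) (hℓs e)
  have hC0 : ∀ x y : ZdEdge d, 0 ≤ (if y = x then 0 else
      (exp a * Real.sqrt (c * v) * |β| * linkInfluence x y + exp (a / 2) * Real.sqrt c * ℓ x y)) :=
    fun x y => by
      split_ifs with hyx
      · exact le_rfl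
      · exact add_nonneg (by positivity) (mul_nonneg (by positivity) (hℓ0 x y hyx))
  have hρ0 : 0 ≤ 6 * ((d : ℝ) - 1) * |β| * (exp a * exp t * Real.sqrt (c * v)) + exp (a / 2) * Real.sqrt c * Λt := by
    have hd0 : 0 < d := hd
    let e₀ : ZdEdge d := (0, ⟨0, hd0⟩)
    exact (tsum_nonneg (hC0 e₀)).trans (hrow e₀).2.2.1
  exact subsingleton_gibbsMeasures_of_summable hγ (fun _ _ => suFrobDist_nonneg _ _) suFrobDist_le
    suFrobDist_self hC0 (fun x => (hrow x).1)
    (fun x ω η φ L hφm hφb hL hφL => abs_integral_siteLaw_perturbedYMS_sub_le_tsum₀ hd hN hc hv hb hP hVB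
      h hWc hWdep hosc hoscs hosca hlip hlips hℓ hℓs' x ω η φ L hφm hφb hL hφL)
    hρ0 hρ (fun x => (hrow x).2.2.1) suEntries measurableSpace_specialUnitaryGroup_eq_comap zero_le_one
    (fun a b => by rw [one_mul]; exact dist_suEntries_le_suFrobDist a b)

end SUN

end Summit.Ventures.YMGap.RobustBall
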